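import Summits.HubbardSuperconductivity.HubbardSuperconductivity.Theorems.KkBandLift.Negative.ThermalShellWitness
import Summits.HubbardSuperconductivity.HubbardSuperconductivity.Theorems.KkBandLift.Negative.NotKkBandLiftOfThermalShell
import Summits.HubbardSuperconductivity.HubbardSuperconductivity.Theorems.KkBandLift.Negative.GibbsShellSelection
import Summits.HubbardSuperconductivity.HubbardSuperconductivity.Theorems.KkBandLift.Negative.SectorPairDecay
import HarnessLib

/-!
# `KkBandLift` (crux stmt-HubbardSuperconductivity-10402, route `KkFloor`) — negative side:
# the strategist's negation skeleton DISCHARGED along its own line N1 + N3 + N4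

Refuter file (B2b-4 gen 2; HONEST FRAMING: the value here is a THEOREM — the bookkeeping stub
`stub_thermalShellWitness_of : GibbsShellSelection → SectorPairDecay → ∀ U δ ∈ (0,½), ThermalShellWitness U δ`
of `Cruxes/KkBandLift/StrategistNegation.lean` proved honestly THROUGH the two interfaces, and the
skeleton's `not_kkBandLift_of_stubs` restated with every stub a hypothesis and then discharged by
the landed extractions; it is NOT summit progress — the verdict `¬ KkBandLift` is already landed,
`Theorems/KkFloorKkBandLiftRefutation.lean`, items 10402–10404 closed `refuted`).

* `norm_sectorGibbsAvg_pairIntensity_le` — `|⟨Δ_g†Δ_g⟩| ≤ Σ_{x,y} G(x,y)` from termwise bounds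
  `|⟨(P_x)†P_y⟩| ≤ G(x,y)` for ANY functional `A ↦ tr (P W A) / tr (P W)` (bilinear expansion
  `Δ_g†Δ_g = Σ_{x,y} (P_x)†P_y`, linearity, triangle inequality);
* `two_mul_log_two_mul_card_fock_div_le` — the entropy price `2 log(2·dim)/β ≤ c L²` at
  `β = 6/c` (`dim = 2^{2L²}`, `log 2 ≤ 1`, `L ≥ 1`);
* `szSector_two_mul_zero_ne_bot` — the sector `(N, S^z) = (2n, 0)`, `n ≤ L²`, is `≠ ⊥`;
* `thermalShellWitness_of_stubs` — **N3 ∧ N4 ⇒ the witness** for every `U` and every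
  `δ ∈ (0, ½)`, all `c > 0` (N3 at `H = hubbardTorus 2 L 1 U`, `A = Δ_d†Δ_d`, `K = szSector (2n) 0`,
  `β = 6/c`; N4 summed over `x, y` and made `≤ (c/2) L⁴` by `eventually_sum_rpow_torusDist_le`);
* `kkBandLift_false_of_stubs` — the skeleton's `not_kkBandLift_of_stubs` with the two remaining
  physics stubs N3 `GibbsShellSelection`, N4 `SectorPairDecay` as HYPOTHESES (verbatim, the local
  abbreviation `sectorGibbsAvg` written out; N1 `FiniteXFloor` is the landed `finiteXFloor`),
  composed from `thermalShellWitness_of_stubs` and the landed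
  `kkBandLift_false_of_thermalShellWitness` (N1 + N2);
* `not_kkBandLift_strategist` — the skeleton's closing `not_kkBandLift : ¬ KkBandLift`, now with
  ZERO `sorry`: `kkBandLift_false_of_stubs gibbsShellSelection sectorPairDecay` (the landed N3
  `Negative/GibbsShellSelection.lean` and N4 `Negative/SectorPairDecay.lean`). A second,
  independent kernel proof of the verdict already booked as `KkFloorKkBandLift_refuted` — along the
  strategist's own line N1 + N3 + N4 rather than the block Gibbs state of
  `Negative/ThermalShellWitness.lean`.

Sources: T. Koma, H. Tasaki, Phys. Rev. Lett. 68 (1992) 3248 = arXiv:cond-mat/9709068 (Theorem,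
eq. (2)–(3), footnote [10], p. 3); H. Tasaki, *Physics and Mathematics of Quantum Many-Body
Systems* (2020) App. A. No definitions.
-/

-- the mandated namespace `Summit.<Summit>.<Problem>.Theorems…` repeats `HubbardSuperconductivity`
-- (single-problem summit, D-0017), which the `dupNamespace` linter flags on every declaration
set_option linter.dupNamespace false
-- structural `Decidable`/`Fintype` instances over `Finset (Orb (FermionTorus 2 L))` exceed the
-- default `synthInstance.maxSize`; tree idiom (`Theorems/LogColdTorusAverageToEveryBlockTrace.lean`)
set_option synthInstance.maxSize 512

noncomputable section

namespace Summit.HubbardSuperconductivity.HubbardSuperconductivity.Theorems.KkBandLift.Negative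

open Matrix MeasureTheory
open Literature.MathematicalPhysics.QuantumLattice Literature.Probability.LatticeModels
  Literature.Barriers.HubbardSuperconductivity
open Summit.HubbardSuperconductivity.TwTipContinuation.Negative (expect_pairIntensity_nonneg)
open Summit.HubbardSuperconductivity.HubbardSuperconductivity.Theses.KkFloor (KkBandLift)
open scoped ComplexOrder

/-! ### Three bookkeeping lemmas -/

/-- **Pair intensity from pair correlations, for any normalised trace functional.** If
`|tr (P W (P_x)†P_y) / tr (P W)| ≤ G(x,y)` for all sites, then
`|tr (P W Δ_g†Δ_g) / tr (P W)| ≤ Σ_{x,y} G(x,y)` (`Δ_g†Δ_g = Σ_{x,y} (P_x)†P_y`). [folklore] -/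
theorem norm_sectorGibbsAvg_pairIntensity_le {L : ℕ} [NeZero L] (g : Site 2 → ℝ)
    (P W : Matrix (Finset (Orb (FermionTorus 2 L))) (Finset (Orb (FermionTorus 2 L))) ℂ)
    (G : TorusSite 2 L → TorusSite 2 L → ℝ)
    (hG : ∀ x y : TorusSite 2 L,
      ‖(P * W * ((localPair g L x)ᴴ * localPair g L y)).trace / (P * W).trace‖ ≤ G x y) :
    ‖(P * W * ((pairField g L)ᴴ * pairField g L)).trace / (P * W).trace‖ ≤
      ∑ x : TorusSite 2 L, ∑ y : TorusSite 2 L, G x y := by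
  have hexp : (pairField g L)ᴴ * pairField g L =
      ∑ x : TorusSite 2 L, ∑ y : TorusSite 2 L, (localPair g L x)ᴴ * localPair g L y := by
    rw [pairField, conjTranspose_sum, Finset.sum_mul_sum]
  have hsum : (P * W * ((pairField g L)ᴴ * pairField g L)).trace / (P * W).trace =
      ∑ x : TorusSite 2 L, ∑ y : TorusSite 2 L,
        (P * W * ((localPair g L x)ᴴ * localPair g L y)).trace / (P * W).trace := by
    rw [hexp, Matrix.mul_sum, trace_sum, Finset.sum_div]
    refine Finset.sum_congr rfl fun x _ => ?_
    rw [Matrix.mul_sum, trace_sum, Finset.sum_div]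
  rw [hsum]
  refine (norm_sum_le _ _).trans (Finset.sum_le_sum fun x _ => ?_)
  exact (norm_sum_le _ _).trans (Finset.sum_le_sum fun y _ => hG x y)

/-- **The entropy price at `β = 6/c`**: `2 log (2 · dim Fock) / (6/c) ≤ c L²` for the torus of
side `L ≥ 1` (`dim Fock = 2^{2L²}`, `log 2 ≤ 1`). [folklore] -/
theorem two_mul_log_two_mul_card_fock_div_le {L : ℕ} [NeZero L] {c : ℝ} (hc : 0 < c) :
    2 * Real.log (2 * Fintype.card (Finset (Orb (FermionTorus 2 L)))) / (6 / c) ≤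
      c * (L : ℝ) ^ 2 := by
  have hcard : Fintype.card (Finset (Orb (FermionTorus 2 L))) = 2 ^ (2 * L ^ 2) := by
    rw [Fintype.card_finset, card_orb]
    simp [FermionTorus, Fintype.card_lex, Fintype.card_fin]
  have hcardR : (2 : ℝ) * Fintype.card (Finset (Orb (FermionTorus 2 L))) = 2 ^ (2 * L ^ 2 + 1) := by
    rw [hcard, pow_succ]
    push_cast
    ring
  have hlog : Real.log (2 * Fintype.card (Finset (Orb (FermionTorus 2 L)))) ≤ 2 * (L : ℝ) ^ 2 + 1 := by
    rw [hcardR, Real.log_pow]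
    calc ((2 * L ^ 2 + 1 : ℕ) : ℝ) * Real.log 2 ≤ ((2 * L ^ 2 + 1 : ℕ) : ℝ) * 1 := by
          gcongr
          exact Real.log_two_lt_d9.le.trans (by norm_num)
      _ = 2 * (L : ℝ) ^ 2 + 1 := by push_cast; ring
  have hL1 : (1 : ℝ) ≤ (L : ℝ) ^ 2 := by
    have h1 : (1 : ℝ) ≤ (L : ℝ) := by exact_mod_cast Nat.pos_of_ne_zero (NeZero.ne L)
    nlinarith
  have h6 : (0 : ℝ) < 6 / c := by positivity
  rw [div_le_iff₀ h6]
  have : c * (L : ℝ) ^ 2 * (6 / c) = 6 * (L : ℝ) ^ 2 := by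
    field_simp
  rw [this]
  linarith

/-- **The half-filled-or-less sector is non-trivial**: `szSector (2n) 0 ≠ ⊥` on the torus of side
`L` for `n ≤ L²` (the basis vector of a configuration `α↑ ∪ α↓`, `|α| = n`). [folklore] -/
theorem szSector_two_mul_zero_ne_bot {L : ℕ} (n : ℕ) (hn : n ≤ L ^ 2) :
    szSector (Λ := FermionTorus 2 L) (2 * n) 0 ≠ ⊥ := by
  obtain ⟨⟨s, hs⟩⟩ := nonempty_sectorBlock (L := L) n hn
  rw [Submodule.ne_bot_iff]
  refine ⟨Pi.single s 1, (mem_szSector_two_mul_zero_iff n _).2 fun s' hs' => ?_, fun h => ?_⟩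
  · have hne : s' ≠ s := fun h => hs' (h ▸ hs)
    exact Pi.single_eq_of_ne hne _
  · have h1 := congrFun h s
    rw [Pi.single_eq_same, Pi.zero_apply] at h1
    exact one_ne_zero h1

/-! ### N3 ∧ N4 ⇒ the thermal-shell witness (the skeleton's bookkeeping stub, honestly) -/

/-- **`stub_thermalShellWitness_of` of `Cruxes/KkBandLift/StrategistNegation.lean`, proved**:
N3 `GibbsShellSelection` and N4 `SectorPairDecay` (both VERBATIM, the local abbreviation
`sectorGibbsAvg H K β A = tr (P_K e^{-βH} A) / tr (P_K e^{-βH})` written out) imply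
`ThermalShellWitness U δ` (verbatim) for every `U` and every doping `δ ∈ (0, ½)`: given `c > 0`
take `β = 6/c`; N4 gives `C, f > 0` with `|⟨(P_x)†P_y⟩_{β,(2n,0)}| ≤ C (dist+1)^{-f}` for all
`L, n, x, y`, hence (`norm_sectorGibbsAvg_pairIntensity_le`, `eventually_sum_rpow_torusDist_le`)
`2 |⟨Δ_d†Δ_d⟩_{β,(2n,0)}| ≤ c L⁴` for `L ≥ L₁`; N3 at `H = hubbardTorus 2 L 1 U` (Hermitian,
preserving `K = szSector (2n) 0 ≠ ⊥`, `n = ⌊(1-δ)L²/2⌋ ≤ L²`), `A = Δ_d†Δ_d ≥ 0`, gives a unit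
`φ ∈ K` with `Re⟨φ,Hφ⟩ ≤ minEnergyOn H K + 2 log(2·2^{2L²})/β ≤ minEnergyOn H K + c L²`
(`two_mul_log_two_mul_card_fock_div_le`) and `Re⟨φ, Δ_d†Δ_d φ⟩ ≤ 2 |⟨Δ_d†Δ_d⟩_{β,K}| ≤ c L⁴`.
[cite: KomaTasakiPRL1992, p. 3] -/
theorem thermalShellWitness_of_stubs
    (h3 : ∀ (n : Type) [Fintype n] [DecidableEq n] (H A : Matrix n n ℂ) (K : Submodule ℂ (n → ℂ))
      (β : ℝ), H.IsHermitian → (∀ v ∈ K, H *ᵥ v ∈ K) →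
      (∀ v : n → ℂ, 0 ≤ (star v ⬝ᵥ A *ᵥ v).re) → K ≠ ⊥ → 0 < β →
      ∃ φ ∈ K, star φ ⬝ᵥ φ = 1 ∧
        (star φ ⬝ᵥ H *ᵥ φ).re ≤ H.minEnergyOn K + 2 * Real.log (2 * Fintype.card n) / β ∧
        (star φ ⬝ᵥ A *ᵥ φ).re ≤
          2 * ‖(projMatrix (K.map ((WithLp.linearEquiv 2 ℂ (n → ℂ)).symm :
                (n → ℂ) →ₗ[ℂ] EuclideanSpace ℂ n)) * gibbsWeight β H * A).trace /
              (projMatrix (K.map ((WithLp.linearEquiv 2 ℂ (n → ℂ)).symm :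
                (n → ℂ) →ₗ[ℂ] EuclideanSpace ℂ n)) * gibbsWeight β H).trace‖)
    (h4 : ∀ (U β : ℝ), 0 < β → ∃ C f : ℝ, 0 < f ∧ ∀ (L : ℕ) [NeZero L] (m : ℕ)
      (x y : TorusSite 2 L),
      ‖(projMatrix ((szSector (Λ := FermionTorus 2 L) (2 * m) 0).map
            ((WithLp.linearEquiv 2 ℂ (Finset (Orb (FermionTorus 2 L)) → ℂ)).symm :
              (Finset (Orb (FermionTorus 2 L)) → ℂ) →ₗ[ℂ]
                EuclideanSpace ℂ (Finset (Orb (FermionTorus 2 L))))) *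
            gibbsWeight β (hubbardTorus 2 L 1 U) *
            ((localPair dWaveFormFactor L x)ᴴ * localPair dWaveFormFactor L y)).trace /
          (projMatrix ((szSector (Λ := FermionTorus 2 L) (2 * m) 0).map
            ((WithLp.linearEquiv 2 ℂ (Finset (Orb (FermionTorus 2 L)) → ℂ)).symm :
              (Finset (Orb (FermionTorus 2 L)) → ℂ) →ₗ[ℂ]
                EuclideanSpace ℂ (Finset (Orb (FermionTorus 2 L))))) *
            gibbsWeight β (hubbardTorus 2 L 1 U)).trace‖ ≤
        C * ((torusDist x y : ℝ) + 1) ^ (-f)) :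
    ∀ U δ : ℝ, δ ∈ Set.Ioo (0 : ℝ) (1 / 2) → ∀ c : ℝ, 0 < c →
      ∃ L₁ : ℕ, ∀ (L : ℕ) [NeZero L], L₁ ≤ L →
        ∃ φ : Fock (Orb (FermionTorus 2 L)),
          φ ∈ szSector (Λ := FermionTorus 2 L) (2 * ⌊(1 - δ) * (L : ℝ) ^ 2 / 2⌋₊) 0 ∧
          star φ ⬝ᵥ φ = 1 ∧
          (star φ ⬝ᵥ hubbardTorus 2 L 1 U *ᵥ φ).re ≤
            (hubbardTorus 2 L 1 U).minEnergyOn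
              (szSector (Λ := FermionTorus 2 L) (2 * ⌊(1 - δ) * (L : ℝ) ^ 2 / 2⌋₊) 0) +
              c * (L : ℝ) ^ 2 ∧
          (star φ ⬝ᵥ ((pairField dWaveFormFactor L)ᴴ * pairField dWaveFormFactor L) *ᵥ φ).re ≤
            c * (L : ℝ) ^ 4 := by
  intro U δ hδ c hc
  have hβ : (0 : ℝ) < 6 / c := by positivity
  obtain ⟨C, f, hf, hCf⟩ := h4 U (6 / c) hβ
  obtain ⟨L₁, hL₁⟩ := eventually_sum_rpow_torusDist_le (le_max_right C 0) hf (half_pos hc)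
  refine ⟨L₁, fun L _ hL => ?_⟩
  have hnL : ⌊(1 - δ) * (L : ℝ) ^ 2 / 2⌋₊ ≤ L ^ 2 := by
    refine Nat.floor_le_of_le ?_
    have h1 : (1 - δ) * (L : ℝ) ^ 2 / 2 ≤ (L : ℝ) ^ 2 := by nlinarith [sq_nonneg (L : ℝ), hδ.1]
    exact_mod_cast h1
  have hHh : (hubbardTorus 2 L 1 U).IsHermitian :=
    hubbardTorus_isHermitian (hamiltonian_isHermitian_and_commute_holds _) 1 U
  have hinv : ∀ v ∈ szSector (Λ := FermionTorus 2 L) (2 * ⌊(1 - δ) * (L : ℝ) ^ 2 / 2⌋₊) 0,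
      hubbardTorus 2 L 1 U *ᵥ v ∈
        szSector (Λ := FermionTorus 2 L) (2 * ⌊(1 - δ) * (L : ℝ) ^ 2 / 2⌋₊) 0 :=
    fun v hv => hubbardTorus_mulVec_mem_szSector 2 L 1 U _ hv
  have hQ : ∀ v : Fock (Orb (FermionTorus 2 L)),
      0 ≤ (star v ⬝ᵥ ((pairField dWaveFormFactor L)ᴴ * pairField dWaveFormFactor L) *ᵥ v).re :=
    fun v => expect_pairIntensity_nonneg L v
  have hK := szSector_two_mul_zero_ne_bot (L := L) _ hnL
  obtain ⟨φ, hφK, hφ1, hφE, hφQ⟩ := h3 (Finset (Orb (FermionTorus 2 L))) (hubbardTorus 2 L 1 U)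
    ((pairField dWaveFormFactor L)ᴴ * pairField dWaveFormFactor L) _ (6 / c) hHh hinv hQ hK hβ
  refine ⟨φ, hφK, hφ1, ?_, ?_⟩
  · have := two_mul_log_two_mul_card_fock_div_le (L := L) hc
    linarith
  · have hPI := norm_sectorGibbsAvg_pairIntensity_le dWaveFormFactor
      (projMatrix ((szSector (Λ := FermionTorus 2 L) (2 * ⌊(1 - δ) * (L : ℝ) ^ 2 / 2⌋₊) 0).map
        ((WithLp.linearEquiv 2 ℂ (Finset (Orb (FermionTorus 2 L)) → ℂ)).symm :
          (Finset (Orb (FermionTorus 2 L)) → ℂ) →ₗ[ℂ]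
            EuclideanSpace ℂ (Finset (Orb (FermionTorus 2 L))))))
      (gibbsWeight (6 / c) (hubbardTorus 2 L 1 U))
      (fun x y => max C 0 * ((torusDist x y : ℝ) + 1) ^ (-f))
      (fun x y => (hCf L ⌊(1 - δ) * (L : ℝ) ^ 2 / 2⌋₊ x y).trans
        (mul_le_mul_of_nonneg_right (le_max_left C 0) (Real.rpow_nonneg (by positivity) _)))
    have hsum := hL₁ L hL
    linarith

/-! ### The skeleton, discharged: (N1 landed) ∧ N3 ∧ N4 ⇒ ¬ KkBandLift -/

/-- **`not_kkBandLift_of_stubs` of `Cruxes/KkBandLift/StrategistNegation.lean` with the two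
remaining physics stubs as HYPOTHESES** (N3 `GibbsShellSelection`, N4 `SectorPairDecay`, verbatim
with `sectorGibbsAvg` written out; N1 `FiniteXFloor` is already the landed theorem `finiteXFloor`,
consumed inside `kkBandLift_false_of_thermalShellWitness`): the strategist's inputs imply
`¬ KkBandLift` — `thermalShellWitness_of_stubs` (N3 + N4 ⇒ witness) composed with the landed
`kkBandLift_false_of_thermalShellWitness` (N1 + N2 ⇒ `¬ KkBandLift` from the witness).
[cite: KomaTasakiPRL1992] -/
theorem kkBandLift_false_of_stubs
    (h3 : ∀ (n : Type) [Fintype n] [DecidableEq n] (H A : Matrix n n ℂ) (K : Submodule ℂ (n → ℂ))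
      (β : ℝ), H.IsHermitian → (∀ v ∈ K, H *ᵥ v ∈ K) →
      (∀ v : n → ℂ, 0 ≤ (star v ⬝ᵥ A *ᵥ v).re) → K ≠ ⊥ → 0 < β →
      ∃ φ ∈ K, star φ ⬝ᵥ φ = 1 ∧
        (star φ ⬝ᵥ H *ᵥ φ).re ≤ H.minEnergyOn K + 2 * Real.log (2 * Fintype.card n) / β ∧
        (star φ ⬝ᵥ A *ᵥ φ).re ≤
          2 * ‖(projMatrix (K.map ((WithLp.linearEquiv 2 ℂ (n → ℂ)).symm :
                (n → ℂ) →ₗ[ℂ] EuclideanSpace ℂ n)) * gibbsWeight β H * A).trace /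
              (projMatrix (K.map ((WithLp.linearEquiv 2 ℂ (n → ℂ)).symm :
                (n → ℂ) →ₗ[ℂ] EuclideanSpace ℂ n)) * gibbsWeight β H).trace‖)
    (h4 : ∀ (U β : ℝ), 0 < β → ∃ C f : ℝ, 0 < f ∧ ∀ (L : ℕ) [NeZero L] (m : ℕ)
      (x y : TorusSite 2 L),
      ‖(projMatrix ((szSector (Λ := FermionTorus 2 L) (2 * m) 0).map
            ((WithLp.linearEquiv 2 ℂ (Finset (Orb (FermionTorus 2 L)) → ℂ)).symm :
              (Finset (Orb (FermionTorus 2 L)) → ℂ) →ₗ[ℂ]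
                EuclideanSpace ℂ (Finset (Orb (FermionTorus 2 L))))) *
            gibbsWeight β (hubbardTorus 2 L 1 U) *
            ((localPair dWaveFormFactor L x)ᴴ * localPair dWaveFormFactor L y)).trace /
          (projMatrix ((szSector (Λ := FermionTorus 2 L) (2 * m) 0).map
            ((WithLp.linearEquiv 2 ℂ (Finset (Orb (FermionTorus 2 L)) → ℂ)).symm :
              (Finset (Orb (FermionTorus 2 L)) → ℂ) →ₗ[ℂ]
                EuclideanSpace ℂ (Finset (Orb (FermionTorus 2 L))))) *
            gibbsWeight β (hubbardTorus 2 L 1 U)).trace‖ ≤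
        C * ((torusDist x y : ℝ) + 1) ^ (-f)) :
    ¬ KkBandLift :=
  kkBandLift_false_of_thermalShellWitness fun U δ _ hδ c hc =>
    thermalShellWitness_of_stubs h3 h4 U δ hδ c hc

/-- **The strategist's skeleton with zero `sorry`: `¬ KkBandLift` along N1 + N3 + N4.**
(`not_kkBandLift` of `Cruxes/KkBandLift/StrategistNegation.lean`, every stub replaced by its landed
extraction: N1 `finiteXFloor`, N3 `gibbsShellSelection`, N4 `sectorPairDecay`.) HONEST FRAMING: a
second kernel-checked proof of an already-booked refutation; not summit progress.
[cite: KomaTasakiPRL1992] -/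
theorem not_kkBandLift_strategist : ¬ KkBandLift :=
  kkBandLift_false_of_stubs gibbsShellSelection sectorPairDecay

end Summit.HubbardSuperconductivity.HubbardSuperconductivity.Theorems.KkBandLift.Negative

end
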